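import Literature.MathematicalPhysics.QuantumFieldTheory.Balaban1983to89.B13
import Literature.MathematicalPhysics.QuantumFieldTheory.Balaban1983to89.B12Limit51
import Literature.MathematicalPhysics.QuantumFieldTheory.Balaban1983to89.FlowStep
import Literature.MathematicalPhysics.QuantumFieldTheory.Balaban1983to89.B12Decay510

/-!
# `Balaban1983to89.B12FormatPlus` — [Balaban1987RG1] §1 (1.6)–(1.22): THE INDUCTIVE FORMAT «Fmt⁺» of the effective
# actions, IN COORDINATES — localized analytic pieces E^{(j)}(X, g, 𝐔, 𝐉) on the spaces U^c_j(X, α₀, α₁) with (1.7)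
# locality, the bound (1.18) with ABSOLUTE constants, (1.19) gauge invariance, Euclidean covariance (p. 263), the
# representation (1.6)–(1.7) of a given functional as the sum of its pieces «(S1)», and the β-readout (1.20)–(1.22);
# as NAMED Prop-valued predicates over a FIXED domain catalogue, with the mould «∃ pieces only» and its kernel links

CITATION HEADER (lean-in-tree rule 2026-08-18).  Source: T. Bałaban, *Renormalization group approach to lattice gauge field
theories. I. Generation of effective actions in a small field approximation and a coupling constant renormalization in four
dimensions*, Commun. Math. Phys. **109** (1987) 249–301, doi:10.1007/bf01215223 = [Balaban1987RG1] (cell paper B12 = «[I]»;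
held `paper:balaban1987-cmp109-rg-i-small-field`, journal page = PDF page + 248; pp. 256–258, 260–264, 290, 298 re-read by
this seat), with the closing sentences of *II. Cluster expansions*, Commun. Math. Phys. **116** (1988) 1–22 [Balaban1988RG2Cluster]
= «[II]» (held `paper:balaban1988-cmp116-rg-ii-cluster`, pp. 1–9 read; journal page = PDF page) for the representation of the
NEW term (Lemma 1 (1.33)–(1.36) p. 9, typed in tree as `B13.Lemma1Printed`).

## What is printed (verbatim; p. = journal page of [I] unless «[II]»)

* p. 261 (1.7): *"We assume that it has the representation 𝐄^{(j)}(g_{j−1}, U_j) = Σ_{X∈𝐃_j} 𝐄^{(j)}(X, g_{j−1}, U_j). (1.7)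
  Again, the term corresponding to a domain X depends on U_j restricted to X."*; p. 261 bottom: *"Thus we assume that there
  are functions 𝐄^{(j)}(X, g_{j−1}, 𝐔, 𝐉), analytic on a space of regular, complex configurations 𝐔, 𝐉, such that
  𝐄^{(j)}(X, g_{j−1}, U_j) = 𝐄^{(j)}(X, g_{j−1}, 𝐔_j, 𝐉_j). (1.9)"*.
* p. 262 (1.10)–(1.16): the gauge action *"(𝐔, 𝐉)^u = (𝐔^u, R(u)𝐉) (1.10)"* and the space *"U^c_j(X, α₀, α₁, γ₀) is a union of
  orbits [(𝐔, 𝐉)] determined by configurations 𝐔, 𝐉 satisfying the four conditions"* (i)–(iv) ((1.11)–(1.16)); p. 263: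
  *"Usually we consider spaces with γ₀ = α₀"*.  (Typed at gauge-field level in `B12RegularSpaces111*`,
  `B12Carve19Sect1InductiveHyp`; here the space is a PARAMETER `Uc`, see «NOT typed».)
* p. 263: *"We assume that the function 𝐄^{(j)}(X, g_{j−1}, 𝐔, 𝐉) is defined and analytic on the space U^c_j(X, α₀, α₁), with
  some positive, absolute constants α₀, α₁ (i.e., constants independent of X and j). It depends on the configurations
  restricted to X, i.e. on (𝐔, 𝐉)|_X. It is a C^∞-function of g_{j−1} ∈ [0, γ], (or analytic), with a positive, absolute γ.
  There exists a constant E₀ such that |𝐄^{(j)}(X, g_{j−1}, 𝐔, 𝐉)| ≦ E₀ exp(−κd_j(X)) (1.18) for M ≧ M(κ), γ sufficiently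
  small, and for all configurations (𝐔, 𝐉) ∈ U^c_j(X, α₀, α₁)."*
* p. 263 (1.19): *"𝐄^{(j)}(X, g_{j−1}, 𝐔^u, R(u)𝐉) = 𝐄^{(j)}(X, g_{j−1}, 𝐔, 𝐉) (1.19) for all G^c-valued gauge transformations u.
  The spaces U^c_j(X, α₀, α₁) are, by the definition, gauge invariant also."*; Euclidean symmetry: *"we notice that the
  explicitly defined expressions in the j-th term in (1.3) are invariant with respect to the Euclidean transformations of the
  lattice T_1^{(j+1)}, and we assume that this is true for all expressions in this term."*
* p. 264 (1.20)–(1.22): the vacuum polarization tensor as the second B-derivative at B = 0 of 𝐄^{(j+1)}(g_j, U_{j+1}(exp iB)),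
  *"Now we take a limit of these functions as T^{(j+1)} ↗ Z^d. This limit exists by the localized representation (1.7). The
  function β_{j+1}(g_j) is defined by … = Σ_x Π_{j+1,μν}(g_j, x)x_μx_ν (1.22) for μ, ν arbitrary, μ ≠ ν"*; the β-clause *"It is
  a smooth function defined on the interval [0, γ], (or analytic), uniformly bounded on this interval together with all
  derivatives."*; and Theorem 3 (p. 264) whose CONCLUSION is «all the inductive assumptions described between (1.1)–(1.22)».
* p. 258 ∕ p. 290: the local coordinates behind the chart — *"U_k = exp iηH′ modulo a gauge transformation, where H′ is a
  regular, g-valued configuration on □ … By the gauge invariance we have 𝐄^{(j)}(X, U_k) = 𝐄^{(j)}(X, exp iηH′)"* (p. 258).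
* [II] p. 9 Lemma 1 (the new term one level up): typed VERBATIM in tree as `B13.Lemma1Printed` ∕ `B13.Bound136` (by name).
* p. 283 (4.8) ∕ p. 284 (4.13)–(4.14) (v3): *"For constant λ we get ⟨(δ∕δB)𝐄(1), i ad_λ B₁⟩ = 0, and since the configuration B₁ is
  arbitrary, we get [λ, (δ∕δB)𝐄(1)] = 0 for all λ ∈ 𝔤^c. The group G is semisimple, hence this is possible only for the element
  0 in the algebra 𝔤^c. Thus we have the first, very important consequence of the gauge invariance (δ∕δB)𝐄(1) = 0. (4.14)"*;
  p. 290: *"For n = 2, and by the identity (4.14), the formula (4.3) yields … (4.35)"*.  (Print's (1.17), p. 263, is the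
  Proposition 9 [15] example estimate — the only display between (1.16) and (1.18) — and is NOT a format row; nothing here cites it.)
* [15] = [Balaban1985Variational] (CMP 102; held `paper:balaban1985-cmp102-variational-background`, journal page = PDF page + 276),
  Prop. 9 p. 309 (v4), verbatim: *"The minimal configuration U_k(V) = U_k(V′V₀) in the axial gauge has an extension to an analytic
  function of G^c-valued small configurations V on 𝔅_k … The function ℋ_k(B) is determined by Eqs. (174), (175), or (179), (180). It
  is an analytic function of B … It satisfies the conditions (19)–(21) … and its functional derivative (182) satisfies the
  inequalities (190)."* ((190) p. 308: exponential decay of the first and second B-derivatives of ℋ_k in the scaled distance;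
  the OCR of the display is illegible in the held text — only its role is typed, as a hypothesis shape); and [I] p. 282 (after
  (4.5)): *"if one of the functions B_i is localized outside the domain X, then we have the additional exponential factor
  exp(−δ₀dist^{(ξ)}(X, supp B_i))"*.

## What is typed here, and how (director-ym №426 ∕ CRIT-1 `CRIT-1-S1-mould-g32.md`: «content in the consequent; every
## non-piece field a NAME; ∃ over the pieces only; E₀, κ outside every binder; the piece index a FIXED catalogue»)

Everything is GENERIC and in COORDINATES: a family index `n : ℕ` (print's level j; for the cell's record: the torus∕volume
index at a fixed level), a FIXED domain catalogue `S : ℕ → Setup.LocDomainSys` (print's 𝐃_j with d_j — a PARAMETER, never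
a free type: the one-piece junk decomposition «Dom := Unit» is untypeable), configurations in `M n` complex coordinates
(`Fin (M n) → ℂ` = the bond variables of (𝐔, 𝐉) on the torus), the spaces `Uc n X ⊆ ℂ^{M n}` (print's U^c_j(X, α₀, α₁)),
the coordinates «in X» `coords n X`, the PIECES `E : Pieces S M` (`E n X : ℂ^{M n} → ℂ`).  The printed clauses are ONE
NAMED PREDICATE EACH, the pieces an explicit argument: `Analytic19 Uc E` (p. 261∕263 analyticity), `Bound118 S Uc E E₀ κ`
((1.18), = `B13.Bound118` at every index, `Iff.rfl`), `Local17 coords E` ((1.7)∕p. 263 «depends on (𝐔, 𝐉)|_X»),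
`GaugeInv119 act Uc E` ((1.19) + invariance of the spaces), `EuclCov dact cact Uc E` (p. 263), `Repr17 S E χ Φf ι` ((1.6)–(1.7)
through a NAMED chart `χ` = background field in local coordinates and a NAMED embedding `ι` of the field variable: the
functional `Φf n` IS the finite sum of its pieces near `0` — the cell's «(S1)»), `PieceVolIndep S M wrap emb πc E` ((1.7)
read across two members of the family: the piece of a domain not wrapping the smaller torus is the same function of the
configuration on X — the configuration-level form the (1.21) limit uses); the β-readout `Pol120` ∕ `Limit121` ∕ `Beta122`.
Then the MOULD `FormatPlus … E₀ κ : Prop := ∃ E, Analytic19 ∧ Bound118 ∧ Local17 ∧ Repr17 ∧ PieceVolIndep` — the ONE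
existential is over the pieces (print: the pieces are OUTPUTS of the renormalization step, [I] §3 + [II]); every other
datum is a parameter; `E₀ κ` outside.  `InductiveFormat` = the mould's rows + (1.19) + Euclidean covariance for GIVEN
pieces (Theorem 3's format as a hypothesis structure).  KERNEL: `FormatPlus.unpack`∕`formatPlus_of_rows` (the mould is
exactly «∃ pieces, rows»), `Repr17.exists_nhds` (the (S1) equation on a neighbourhood), `Bound118.mono`,
`abs_beta_le_of_limit121` ((1.21)-limits of kernels obeying (5.10) uniformly obey it, hence |β_{j+1}| ≦ β′₅.₁₀ by (1.22):
`B12Limit51.decay510_of_tendsto` + `B12Sec2to5.secondMoment_abs_le_of_decay510` — the β-clause's bound from the format's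
volume-uniform decay), `betaBox_of_limit121` (the same as the flow letters `FlowStep.BetaUpperH`∕`BetaLowerH (−·)` on a box of
histories = the shape of the K0⁷ stub of `Summits/…/BalabanUVNodesK0V23Defs`).  v2 (§5, APPEND): `Chart44` — the
PIECES-FREE chart obligation of [I] (4.4) p. 281 ∕ (3.36)–(3.54) (chart entire, α₂-ball ↦ U^c; `α₂` absolute, outside) — with
`Chart44.rowE` ∕ `FormatPlus.rowE_repr` (the (1.18) bound transported along the chart: the «row E» shape, content-free).
v3 (§6–§7, APPEND; the NODE-O cover's pen `LENS-1-B12FormatPlusV3-append-draft-v1.1.lean` sha16 0763b1832a400d82, read on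
bytes by the cell critic — statements and proofs landed byte-identical, docstring cites re-checked against pp. 283–284, 290):
§6 the WARD ROW — «G is semisimple» IN COORDINATES as `NoInvariantCovector A` (the linear action of the constant rotations on
chart inputs has no non-zero invariant covector — a hypothesis on the NAMED action, never on the pieces), the calculus lemma
`fderiv_eq_zero_of_invariant_noFixedCovector` (invariance near 0 + differentiability + no invariant covector ⟹ `Df(0) = 0`:
print's three lines (4.13) ⟹ (4.14)), the row `Ward414 χ E` ((4.14) per charted piece at the chart origin, hypothesis form),
the pieces-free intertwining `ChartEquivariant toG act χ A` (rotations indexed by their OWN family `H n` with a named map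
`toG n` into the (1.10) gauge group), and `ward414_of_gaugeInv119` : `GaugeInv119` + `ChartEquivariant` + `Chart44` (α₂ > 0) +
`Analytic19` + `∀ n, NoInvariantCovector (A n)` ⟹ `Ward414`; §7 the MOULDS WITH A SIXTH CONJUNCT FOR THE SAME PIECES —
`FormatPlusG … act … E₀ κ := ∃ E, ⟨the five rows⟩ ∧ GaugeInv119 act Uc E` ((1.19) under the one `∃`) ⊇ `FormatPlusW := ∃ E,
⟨the five rows⟩ ∧ Ward414 χ E` ⊇ `FormatPlus`, with `formatPlus_of_formatPlusG`, `formatPlus_of_formatPlusW`,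
`formatPlusW_of_formatPlusG` (the (1.19)-mould + equivariant chart + no invariant covector give the Ward-mould for the SAME
pieces) and `FormatPlusW.rows_for_435` (the binder list the (4.35) p. 290 bridge consumes: pieces∘chart `C²` at 0, locality,
the (S1) neighbourhood, the two-volume identity, (4.14)).
v4 (§8, APPEND; director-ym №443 (1) «route (ii)»: the generic carrier the porting item 27931‴ reads, typed in Literature
like (A1), the record instance being the definer's Summit-side names): `restrictCLM` (+ `restrictCLM_apply`), the RESPONSE
DATA carrier `Response9Data S M m d` (cube cover, labels, site geometry `B12Decay510.SiteGeometry`, label metric, window labels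
`e n μ z` with `μ : Fin d`, `z : ℤ^d`, chart-input sets «in X», `siteOf`, the responses `Gk`, and the two-volume data `wrap ∕ emb ∕
jX ∕ πc`) and the predicate `Response9 R χ N C₉ δ₀ w` = (R0) signs ∧ (R1) [15] Prop. 9 RESPONSE DECAY ∧ (R2) coordinate width ∧
(R3) unwrap compatibility ∧ (R4) the two-volume response comparison on the window `2|z| < N n` at rate `e^{−δ₀N∕2}` ∧ (R5) the
chart intertwining through `restrictCLM` — constants OUTSIDE, every datum a NAME, hypothesis form; print labels row by row in
the docstring ((R1) PRINTED [15] Prop. 9; (R2)–(R5) the explicit two-volume ∕ chart-side forms are OURS, implicit in (1.7),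
(1.21), (4.35)); API `Response9.consts_nonneg`, `.decay`, `.decay_distD` ((R1)+(R2) ⟹ the p. 282 factor
`C₉e^{δ₀w}e^{−δ₀dist(y,X)}`), `.intertwine`.  Field-for-field = the NODE-O cover's Summit-side mirror `ResponseDataOver ∕
ResponseObligationsOver` at `d = 4` (same field names, order and row order), so the mirror can be retired by `rfl`.
v5 (§9, APPEND; the cell's located repair «R-O2» — critic ym-nodeO-crit-1, adopted by director-ym №444: at the record the
spaces `U^c_{k+1}` are ξ²-THIN (ξ = L^{−(k+1)}, (1.11)∕(1.14)) while the exp-chart is unscaled, so a k-uniform POLYDISC `ball 0 α₂`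
mapping into them is FALSE; print's (4.4) p. 281 is a convex balanced neighbourhood in ξ-SCALED norms): `Chart44D S M Uc m χ D` —
the chart obligation ON A NAMED DOMAIN `D n X` (Convex ℝ ∧ Balanced ℂ ∧ IsOpen ∧ 0 ∈ D ∧ χ analytic on D ∧ MapsTo D → Uc), with
`chart44D_ball_of_chart44` (the v2 polydisc row is the special case) and `Chart44D.rowE` ((1.18) transported onto D); `cutTo`
(+ `cutTo_apply`); and `Response9D R χ N D C₉ δ₀` — the response rows with the two DECAY rows in the Minkowski GAUGE (Mathlib
`gauge`) of `D n X` of the response CUT to the chart inputs of X, decaying in dist(label, X) ([15] Prop. 9 read as [I] p. 282's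
«additional exponential factor exp(−δ₀dist(X, supp B_i))»), the window comparison likewise, unwrap compatibility and intertwining
unchanged; API `Response9D.consts_nonneg ∕ .decay ∕ .intertwine`.  LESSON (cell rule): every chart∕analyticity row at a record's
names states its domain in print's SCALED norms, never a k-uniform polydisc in unscaled chart coordinates.

HONEST FRAMING.  Hypothesis SHAPES and bookkeeping: no predicate below is asserted for Bałaban's actual effective actions;
the pieces, spaces, charts of the cell's record are NOT constructed here (definer's lane, Summits side); Theorem 3 is
print-proved (claimed: [I] §§2–5 + [II] p. 22) and UNPORTED; Theorem 2 is unproved in print and off this road; nothing is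
discharged; the Yang–Mills mass gap (Clay) is NOT proved by any of this.  No new named fact (no closed `def … : Prop`
asserted true); no `sorry`, no `instance`, no `notation`.  Consumers (by name, outside the tree today): the NODE-O cover's
Summit-side dictionary draft `N3PortDictionaryDraft` (`FmtDataOver`, `S1T1MouldSk` — same field shapes, so it can rebase on
these names by `Iff.rfl`∕field reordering) and the porting items `stmt-QuantumFields-27930∕27931∕27932`.

NOT typed here (by name elsewhere, or deliberately a parameter): the conditions (i)–(iv) (1.11)–(1.16) defining U^c_j
(`B12RegularSpaces111*`, `B12Carve19Sect1InductiveHyp.RegularSpaceInSpacesPrinted`) — `Uc` is a parameter; the abstract-Φ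
tower `Step.SFTower`∕`Step.SFHyp` (Markov coupling, no complex structure — this module is its coordinate companion, not a
replacement); the finite-volume tensor (1.20) with its body (`B12PolarizationTensor120.polTensor∕polComp`, record side
`Node00.BetaOfRecord.polWindow∕polLimit`) — `pol` is a parameter; the regularity of the pieces ∕ of β in the coupling
(`B12CouplingClausesHistory`, `B12BetaSmooth`); [II] Lemma 1–3 and the step (`B13.*`, `B12Thm3Assembly`); Theorem 2 (`B12.Thm2Printed`,
`B12Thm2PrintSkeleton`).
-/

namespace Literature.MathematicalPhysics.QuantumFieldTheory.Balaban1983to89.B12FormatPlus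

open Literature.MathematicalPhysics.QuantumFieldTheory.Balaban1983to89
open _root_.Filter _root_.Topology

noncomputable section

/-! ## 1. Carriers: a fixed domain catalogue, complex coordinates, pieces -/

/-- **The pieces in coordinates.**  For each member `n` of the family (print: the level j; for the cell's record: the
volume index at a fixed level) and each localization domain `X ∈ 𝐃` of the FIXED catalogue `S n` (print p. 257: the class
𝐃_j of localization domains with the linear size d_j(X); tree `Setup.LocDomainSys`), a function of the `M n` complex
coordinates of the configuration pair (𝐔, 𝐉) — print's `𝐄^{(j)}(X, g_{j−1}, 𝐔, 𝐉)` of (1.9) at a fixed coupling history.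
[cite: Balaban1987RG1, (1.7) and (1.9) p.261] -/
abbrev Pieces (S : ℕ → LocDomainSys) (M : ℕ → ℕ) : Type :=
  (n : ℕ) → (S n).Dom → (Fin (M n) → ℂ) → ℂ

/-! ## 2. The printed clauses, one named predicate each (pieces explicit) -/

section Rows

variable {S : ℕ → LocDomainSys} {M : ℕ → ℕ}

/-- **Analyticity** — p. 261 *"analytic on a space of regular, complex configurations 𝐔, 𝐉"*, p. 263 *"defined and analytic on
the space U^c_j(X, α₀, α₁)"*: each piece is analytic on (a neighbourhood of each point of) the NAMED space `Uc n X`.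
[cite: Balaban1987RG1, (1.9) p.261 and p.263 (before (1.18))] -/
def Analytic19 (Uc : (n : ℕ) → (S n).Dom → Set (Fin (M n) → ℂ)) (E : Pieces S M) : Prop :=
  ∀ n X, AnalyticOnNhd ℂ (E n X) (Uc n X)

/-- **(1.18)** p. 263, verbatim: *"There exists a constant E₀ such that |𝐄^{(j)}(X, g_{j−1}, 𝐔, 𝐉)| ≦ E₀ exp(−κd_j(X)) (1.18) …
for all configurations (𝐔, 𝐉) ∈ U^c_j(X, α₀, α₁)"* — at EVERY member of the family with the SAME `E₀`, `κ` (p. 263: *"absolute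
constants … independent of X and j"*); = the tree's one-system predicate `B13.Bound118` at each index. [cite: Balaban1987RG1, (1.18) p.263] -/
def Bound118 (S : ℕ → LocDomainSys) (Uc : (n : ℕ) → (S n).Dom → Set (Fin (M n) → ℂ)) (E : Pieces S M) (E₀ κ : ℝ) :
    Prop :=
  ∀ n, B13.Bound118 (S n) (Uc n) (E n) E₀ κ

/-- Unfolding (definitional): `Bound118` is the displayed inequality at every (n, X, u ∈ Uc n X). [cite: Balaban1987RG1, (1.18) p.263] -/
theorem bound118_iff (Uc : (n : ℕ) → (S n).Dom → Set (Fin (M n) → ℂ)) (E : Pieces S M) (E₀ κ : ℝ) :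
    Bound118 S Uc E E₀ κ ↔ ∀ n X u, u ∈ Uc n X → ‖E n X u‖ ≤ E₀ * Real.exp (-κ * (S n).dj X) :=
  Iff.rfl

/-- (1.18) is monotone in its constants: a larger `E₀` and a smaller `κ` still bound (d_j(X) ≧ 0). [cite: Balaban1987RG1, (1.18) p.263 (bookkeeping)] -/
theorem Bound118.mono {Uc : (n : ℕ) → (S n).Dom → Set (Fin (M n) → ℂ)} {E : Pieces S M} {E₀ E₀' κ κ' : ℝ}
    (h : Bound118 S Uc E E₀ κ) (hE : E₀ ≤ E₀') (hκ : κ' ≤ κ) (hE₀ : 0 ≤ E₀) : Bound118 S Uc E E₀' κ' := by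
  intro n X u hu
  refine (h n X u hu).trans ?_
  have hd : 0 ≤ (S n).dj X := (S n).dj_nonneg X
  have hexp : Real.exp (-κ * (S n).dj X) ≤ Real.exp (-κ' * (S n).dj X) :=
    Real.exp_le_exp.mpr (by nlinarith)
  exact mul_le_mul hE hexp (Real.exp_pos _).le (hE₀.trans hE)

/-- **(1.7) locality** p. 261, verbatim: *"the term corresponding to a domain X depends on U_j restricted to X"*; p. 263: *"It
depends on the configurations restricted to X, i.e. on (𝐔, 𝐉)|_X"* — in coordinates: the piece of `X` factors through the
NAMED coordinates «in X», `coords n X`. [cite: Balaban1987RG1, (1.7) p.261 and p.263] -/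
def Local17 (coords : (n : ℕ) → (S n).Dom → Finset (Fin (M n))) (E : Pieces S M) : Prop :=
  ∀ n X u u', (∀ i ∈ coords n X, u i = u' i) → E n X u = E n X u'

/-- **(1.19) gauge invariance** p. 263, verbatim: *"𝐄^{(j)}(X, g_{j−1}, 𝐔^u, R(u)𝐉) = 𝐄^{(j)}(X, g_{j−1}, 𝐔, 𝐉) (1.19) for all
G^c-valued gauge transformations u. The spaces U^c_j(X, α₀, α₁) are, by the definition, gauge invariant also."* — for a NAMED
action `act n g` of the gauge transformations ((1.10) `(𝐔, 𝐉)^u = (𝐔^u, R(u)𝐉)` in coordinates). [cite: Balaban1987RG1, (1.10) p.262 and (1.19) p.263] -/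
def GaugeInv119 {G : ℕ → Type*} (act : (n : ℕ) → G n → (Fin (M n) → ℂ) → (Fin (M n) → ℂ))
    (Uc : (n : ℕ) → (S n).Dom → Set (Fin (M n) → ℂ)) (E : Pieces S M) : Prop :=
  (∀ n (g : G n) X, Set.MapsTo (act n g) (Uc n X) (Uc n X)) ∧ ∀ n (g : G n) X u, E n X (act n g u) = E n X u

/-- **Euclidean covariance** p. 263, verbatim: *"we notice that the explicitly defined expressions in the j-th term in (1.3) are
invariant with respect to the Euclidean transformations of the lattice T_1^{(j+1)}, and we assume that this is true for all
expressions in this term"* — piecewise: a lattice symmetry `r` moves domains (`dact`) and coordinates (`cact`), preserving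
the spaces, and `E(rX, r·u) = E(X, u)`; the invariance of the SUM (1.7) follows by reindexing. [cite: Balaban1987RG1, p.263 (Euclidean lattice transformations)] -/
def EuclCov {R : ℕ → Type*} (dact : (n : ℕ) → R n → (S n).Dom → (S n).Dom)
    (cact : (n : ℕ) → R n → (Fin (M n) → ℂ) → (Fin (M n) → ℂ))
    (Uc : (n : ℕ) → (S n).Dom → Set (Fin (M n) → ℂ)) (E : Pieces S M) : Prop :=
  (∀ n (r : R n) X, Set.MapsTo (cact n r) (Uc n X) (Uc n (dact n r X))) ∧
    ∀ n (r : R n) X u, E n (dact n r X) (cact n r u) = E n X u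

/-- **The representation (1.6)–(1.7) of a NAMED functional as the sum of its pieces — the cell's «(S1)».**  Print p. 261
(1.7): *"𝐄^{(j)}(g_{j−1}, U_j) = Σ_{X∈𝐃_j} 𝐄^{(j)}(X, g_{j−1}, U_j)"*, with (1.9) and the local coordinates of p. 258 (*"U_k =
exp iηH′ modulo a gauge transformation … 𝐄^{(j)}(X, U_k) = 𝐄^{(j)}(X, exp iηH′)"*): for each member `n`, the functional
`Φf n : W n → ℂ` of the field variable `B` (the effective action — or its new term — composed with the background field in
local coordinates) equals, for `B` near `0`, the FINITE sum over the catalogue `S n` of the pieces evaluated at the NAMED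
chart `χ n X` of the NAMED coordinates `ι n B`.  Only the germ at `B = 0` is asserted (what (1.20) reads). [cite: Balaban1987RG1, (1.6)–(1.7) p.261, (1.9) p.261, p.258] -/
def Repr17 (S : ℕ → LocDomainSys) {M : ℕ → ℕ} (E : Pieces S M) {m : ℕ → ℕ}
    (χ : (n : ℕ) → (S n).Dom → (Fin (m n) → ℂ) → (Fin (M n) → ℂ))
    {W : ℕ → Type*} [∀ n, TopologicalSpace (W n)] [∀ n, Zero (W n)]
    (Φf : (n : ℕ) → W n → ℂ) (ι : (n : ℕ) → W n → (Fin (m n) → ℂ)) : Prop :=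
  ∀ n, ∀ᶠ B in 𝓝 (0 : W n), Φf n B = ∑ X : (S n).Dom, E n X (χ n X (ι n B))

/-- **(1.7) across two members of the family** (the configuration-level identity the limit (1.21) uses, p. 264 *"This limit
exists by the localized representation (1.7)"*): for a domain `X` of member `n` outside the NAMED exceptional class `wrap n`
(for tori: the domains wrapping the smaller torus), its piece at member `n + 1` (through the NAMED domain embedding `emb n`)
IS its piece at member `n` composed with the NAMED coordinate projection `πc n X` — the piece of X is one function of the
configuration on X, whichever lattice X sits in. [cite: Balaban1987RG1, (1.7) p.261 with (1.21) p.264] -/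
def PieceVolIndep (S : ℕ → LocDomainSys) (M : ℕ → ℕ) (wrap : (n : ℕ) → Finset (S n).Dom)
    (emb : (n : ℕ) → (S n).Dom → (S (n + 1)).Dom)
    (πc : (n : ℕ) → (S n).Dom → (Fin (M (n + 1)) → ℂ) → (Fin (M n) → ℂ)) (E : Pieces S M) : Prop :=
  ∀ n X, X ∉ wrap n → ∀ u', E (n + 1) (emb n X) u' = E n X (πc n X u')

/-- The (S1) equation on an honest neighbourhood: `Repr17` hands, for each member, a set `U ∈ 𝓝 0` on which the functional IS
the sum of the charted pieces. [cite: Balaban1987RG1, (1.6)–(1.7) p.261 (bookkeeping)] -/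
theorem Repr17.exists_nhds {E : Pieces S M} {m : ℕ → ℕ} {χ : (n : ℕ) → (S n).Dom → (Fin (m n) → ℂ) → (Fin (M n) → ℂ)}
    {W : ℕ → Type*} [∀ n, TopologicalSpace (W n)] [∀ n, Zero (W n)] {Φf : (n : ℕ) → W n → ℂ}
    {ι : (n : ℕ) → W n → (Fin (m n) → ℂ)} (h : Repr17 S E χ Φf ι) (n : ℕ) :
    ∃ U ∈ 𝓝 (0 : W n), ∀ B ∈ U, Φf n B = ∑ X : (S n).Dom, E n X (χ n X (ι n B)) :=
  (h n).exists_mem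

end Rows

/-! ## 3. The β-readout (1.20)–(1.22) and the β-clause's bound from volume-uniform decay -/

section Beta

variable {d : ℕ}

/-- **(1.20)** p. 264: the finite-volume vacuum-polarization kernels of the family ARE the polarizations (second
`B`-derivatives at `B = 0`, colour trace taken) of the functionals `Φf n` — for a NAMED polarization operation `pol n` (tree
bodies: `B12PolarizationTensor120.polTensor∕polComp`, record side `Node00.BetaOfRecord.polWindow`). [cite: Balaban1987RG1, (1.20)–(1.21) p.264] -/
def Pol120 {W : ℕ → Type*} (pol : (n : ℕ) → (W n → ℂ) → B12Beta.Kernel d) (Φf : (n : ℕ) → W n → ℂ)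
    (Pvol : ℕ → B12Beta.Kernel d) : Prop :=
  ∀ n, Pvol n = pol n (Φf n)

/-- **(1.21)** p. 264, verbatim: *"Now we take a limit of these functions as T^{(j+1)} ↗ Z^d. This limit exists by the localized
representation (1.7)."* — pointwise convergence of the finite-volume kernels along the family to a kernel on ℤ^d.
[cite: Balaban1987RG1, (1.21) p.264] -/
def Limit121 (Pvol : ℕ → B12Beta.Kernel d) (Plim : B12Beta.Kernel d) : Prop :=
  ∀ μ ν x, Tendsto (fun n => Pvol n μ ν x) atTop (𝓝 (Plim μ ν x))

/-- **(1.22)** p. 264 = (5.42) p. 297 (*"This is the fundamental equality defining the β-function"*): the number `b`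
(print's β_{j+1}(g_j) at the given history) is the off-diagonal second moment `Σ_x Π_{μν}(x)x_μx_ν`, `μ ≠ ν`, of the limit
kernel (`B12Beta.secondMoment`, no prefactor — as printed). [cite: Balaban1987RG1, (1.22) p.264 and (5.42) p.297] -/
def Beta122 (Plim : B12Beta.Kernel d) (μ ν : Fin d) (b : ℝ) : Prop :=
  b = B12Beta.secondMoment Plim μ ν

/-- **The β-clause's BOUND from the format, kernel-checked**: if the finite-volume kernels obey the decay (5.10) p. 293 with
ONE pair of constants `(C, δ₁)` along the family (volume-uniformly — p. 263 «absolute constants») and converge pointwise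
(1.21), the limit kernel obeys (5.10) (`B12Limit51.decay510_of_tendsto`) and the β of (1.22) satisfies
`|b| ≦ β′₅.₁₀ = B12Sec2to5.betaPrime510 d C δ₁` (`B12Sec2to5.secondMoment_abs_le_of_decay510`) — p. 264 «uniformly bounded».
[cite: Balaban1987RG1, p.264 (β-clause) with (1.21)–(1.22) p.264 and (5.10) p.293] -/
theorem abs_beta_le_of_limit121 {Pvol : ℕ → B12Beta.Kernel d} {Plim : B12Beta.Kernel d} {μ ν : Fin d} {b C δ₁ : ℝ}
    (hδ : 0 < δ₁) (hdec : ∀ n, B12Sec2to5.Decay510 (Pvol n μ ν) C δ₁) (hlim : Limit121 Pvol Plim)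
    (hb : Beta122 Plim μ ν b) : |b| ≤ B12Sec2to5.betaPrime510 d C δ₁ := by
  have hP : B12Sec2to5.Decay510 (Plim μ ν) C δ₁ :=
    B12Limit51.decay510_of_tendsto (fun n => Pvol n μ ν) (Plim μ ν) C δ₁ hdec (hlim μ ν)
  rw [hb]
  exact (B12Sec2to5.secondMoment_abs_le_of_decay510 hδ hP).2

/-- **… and as the flow letters on a box of histories** (the SHAPE of the K0⁷ stub of `Summits/…/BalabanUVNodesK0V23Defs`): if
for every scale `k` and every coupling history `v ∈ ]0,γ₀]^{k+1}` the value `β k v` is the (1.22)-moment of a (1.21)-limit of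
finite-volume kernels obeying (5.10) with the SAME `(C, δ₁)`, then `FlowStep.BetaUpperH β′₅.₁₀ γ₀ β ∧ FlowStep.BetaLowerH
(−β′₅.₁₀) γ₀ β`.  Bookkeeping on `abs_beta_le_of_limit121`. [cite: Balaban1987RG1, p.264 (β-clause) with (1.21)–(1.22) p.264 and (5.10) p.293] -/
theorem betaBox_of_limit121 {β : FlowStep.HBeta} {γ₀ C δ₁ : ℝ} {μ ν : Fin d} (hδ : 0 < δ₁)
    (Pvol : (k : ℕ) → (Fin (k + 1) → ℝ) → ℕ → B12Beta.Kernel d) (Plim : (k : ℕ) → (Fin (k + 1) → ℝ) → B12Beta.Kernel d)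
    (hdec : ∀ k v, v ∈ FlowStep.Box γ₀ k → ∀ n, B12Sec2to5.Decay510 (Pvol k v n μ ν) C δ₁)
    (hlim : ∀ k v, v ∈ FlowStep.Box γ₀ k → Limit121 (Pvol k v) (Plim k v))
    (hb : ∀ k v, v ∈ FlowStep.Box γ₀ k → Beta122 (Plim k v) μ ν (β k v)) :
    FlowStep.BetaUpperH (B12Sec2to5.betaPrime510 d C δ₁) γ₀ β ∧
      FlowStep.BetaLowerH (-B12Sec2to5.betaPrime510 d C δ₁) γ₀ β := by
  refine ⟨fun k v hv => ?_, fun k v hv => ?_⟩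
  · exact (le_abs_self _).trans (abs_beta_le_of_limit121 hδ (hdec k v hv) (hlim k v hv) (hb k v hv))
  · exact (neg_le_neg (abs_beta_le_of_limit121 hδ (hdec k v hv) (hlim k v hv) (hb k v hv))).trans (neg_abs_le _)

end Beta

/-! ## 4. The format as ONE hypothesis structure for given pieces, and the mould «∃ pieces only» -/

section Format

variable {S : ℕ → LocDomainSys} {M m : ℕ → ℕ}

/-- **THEOREM 3's FORMAT for GIVEN pieces** (the inductive assumptions (1.7), (1.9)∕p. 263 analyticity, (1.18), (1.19), p. 263
Euclidean covariance and the representation (1.6)–(1.7), over a fixed catalogue and NAMED spaces ∕ coordinates ∕ actions ∕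
chart ∕ functional): a structure of HYPOTHESES on `E`, asserted for no `E`.  The β-clause is not a field: its bound is a
CONSEQUENCE of the format's volume-uniform decay (§3), its regularity in the coupling lives in `B12CouplingClausesHistory`.
[cite: Balaban1987RG1, §1 (1.6)–(1.19) pp.261–263 and Thm 3 p.264] -/
structure InductiveFormat (S : ℕ → LocDomainSys) (M : ℕ → ℕ) (Uc : (n : ℕ) → (S n).Dom → Set (Fin (M n) → ℂ))
    (coords : (n : ℕ) → (S n).Dom → Finset (Fin (M n))) {G R : ℕ → Type*}
    (act : (n : ℕ) → G n → (Fin (M n) → ℂ) → (Fin (M n) → ℂ)) (dact : (n : ℕ) → R n → (S n).Dom → (S n).Dom)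
    (cact : (n : ℕ) → R n → (Fin (M n) → ℂ) → (Fin (M n) → ℂ)) (m : ℕ → ℕ)
    (χ : (n : ℕ) → (S n).Dom → (Fin (m n) → ℂ) → (Fin (M n) → ℂ)) {W : ℕ → Type*} [∀ n, TopologicalSpace (W n)]
    [∀ n, Zero (W n)] (Φf : (n : ℕ) → W n → ℂ) (ι : (n : ℕ) → W n → (Fin (m n) → ℂ)) (E₀ κ : ℝ) (E : Pieces S M) :
    Prop where
  analytic : Analytic19 Uc E
  bound : Bound118 S Uc E E₀ κ
  locality : Local17 coords E
  gauge : GaugeInv119 act Uc E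
  eucl : EuclCov dact cact Uc E
  repr : Repr17 S E χ Φf ι

/-- **THE MOULD «Fmt⁺ + (S1)», ∃ OVER THE PIECES ONLY** — for the NAMED catalogue `S`, coordinate dimensions `M`, spaces
`Uc`, coordinates `coords`, chart `⟨m, χ⟩`, functional `Φf`, embedding `ι`, exceptional class `wrap`, domain embedding `emb` and
coordinate projection `πc`, and the ABSOLUTE constants `E₀ κ` given from OUTSIDE: there EXISTS a family of pieces, analytic
on the spaces, obeying (1.18) with `(E₀, κ)`, local in the coordinates, summing through the chart to the functional near 0 at
every member, and volume-independent off the exceptional class.  Print: the pieces are OUTPUTS of the renormalization step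
([I] (2.13) p. 268 + §3 + [II]); every other datum is definable beforehand — hence the single existential.  (Same field
shapes, in this order, as the NODE-O cover's Summit-side draft `S1T1MouldSk`.)  Asserted for nothing. [cite: Balaban1987RG1, (1.6)–(1.7) p.261, (1.9) p.261, (1.18) p.263, (1.21) p.264] -/
def FormatPlus (S : ℕ → LocDomainSys) (M : ℕ → ℕ) (Uc : (n : ℕ) → (S n).Dom → Set (Fin (M n) → ℂ))
    (coords : (n : ℕ) → (S n).Dom → Finset (Fin (M n))) (m : ℕ → ℕ)
    (χ : (n : ℕ) → (S n).Dom → (Fin (m n) → ℂ) → (Fin (M n) → ℂ)) {W : ℕ → Type*} [∀ n, TopologicalSpace (W n)]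
    [∀ n, Zero (W n)] (Φf : (n : ℕ) → W n → ℂ) (ι : (n : ℕ) → W n → (Fin (m n) → ℂ))
    (wrap : (n : ℕ) → Finset (S n).Dom) (emb : (n : ℕ) → (S n).Dom → (S (n + 1)).Dom)
    (πc : (n : ℕ) → (S n).Dom → (Fin (M (n + 1)) → ℂ) → (Fin (M n) → ℂ)) (E₀ κ : ℝ) : Prop :=
  ∃ E : Pieces S M, Analytic19 Uc E ∧ Bound118 S Uc E E₀ κ ∧ Local17 coords E ∧ Repr17 S E χ Φf ι ∧
    PieceVolIndep S M wrap emb πc E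

variable {Uc : (n : ℕ) → (S n).Dom → Set (Fin (M n) → ℂ)} {coords : (n : ℕ) → (S n).Dom → Finset (Fin (M n))}
  {χ : (n : ℕ) → (S n).Dom → (Fin (m n) → ℂ) → (Fin (M n) → ℂ)} {W : ℕ → Type*} [∀ n, TopologicalSpace (W n)]
  [∀ n, Zero (W n)] {Φf : (n : ℕ) → W n → ℂ} {ι : (n : ℕ) → W n → (Fin (m n) → ℂ)}
  {wrap : (n : ℕ) → Finset (S n).Dom} {emb : (n : ℕ) → (S n).Dom → (S (n + 1)).Dom}
  {πc : (n : ℕ) → (S n).Dom → (Fin (M (n + 1)) → ℂ) → (Fin (M n) → ℂ)} {E₀ κ : ℝ}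

/-- The named rows for given pieces inhabit the mould (nothing lost). [cite: Balaban1987RG1, §1 pp.261–263 (bookkeeping)] -/
theorem formatPlus_of_rows (E : Pieces S M) (hA : Analytic19 Uc E) (hB : Bound118 S Uc E E₀ κ)
    (hL : Local17 coords E) (hR : Repr17 S E χ Φf ι) (hV : PieceVolIndep S M wrap emb πc E) :
    FormatPlus S M Uc coords m χ Φf ι wrap emb πc E₀ κ :=
  ⟨E, hA, hB, hL, hR, hV⟩

/-- Unpacking the mould: SOME pieces with all five rows, the (1.18) row displayed at every (n, X, u ∈ Uc n X), the (S1) row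
on a neighbourhood of 0 at every member (nothing added). [cite: Balaban1987RG1, §1 pp.261–263 (bookkeeping)] -/
theorem FormatPlus.unpack (h : FormatPlus S M Uc coords m χ Φf ι wrap emb πc E₀ κ) :
    ∃ E : Pieces S M, Analytic19 Uc E ∧ (∀ n X u, u ∈ Uc n X → ‖E n X u‖ ≤ E₀ * Real.exp (-κ * (S n).dj X)) ∧
      Local17 coords E ∧ (∀ n, ∃ U ∈ 𝓝 (0 : W n), ∀ B ∈ U, Φf n B = ∑ X : (S n).Dom, E n X (χ n X (ι n B))) ∧
      PieceVolIndep S M wrap emb πc E := by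
  obtain ⟨E, hA, hB, hL, hR, hV⟩ := h
  exact ⟨E, hA, (bound118_iff Uc E E₀ κ).1 hB, hL, fun n => hR.exists_nhds n, hV⟩

/-- The format for given pieces (with any actions) plus the two-volume identity inhabits the mould — Theorem 3's format is
STRONGER than what the β-road mould keeps ((1.19) and Euclidean covariance are dropped). [cite: Balaban1987RG1, §1 pp.261–263 and Thm 3 p.264 (bookkeeping)] -/
theorem InductiveFormat.formatPlus {G R : ℕ → Type*} {act : (n : ℕ) → G n → (Fin (M n) → ℂ) → (Fin (M n) → ℂ)}
    {dact : (n : ℕ) → R n → (S n).Dom → (S n).Dom} {cact : (n : ℕ) → R n → (Fin (M n) → ℂ) → (Fin (M n) → ℂ)}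
    {E : Pieces S M} (h : InductiveFormat S M Uc coords act dact cact m χ Φf ι E₀ κ E)
    (hV : PieceVolIndep S M wrap emb πc E) : FormatPlus S M Uc coords m χ Φf ι wrap emb πc E₀ κ :=
  formatPlus_of_rows E h.analytic h.bound h.locality h.repr hV

end Format

/-! ## 5. The background chart (v2 APPEND): [I] (4.4) p. 281 with (3.36)–(3.54) pp. 277–280 — pieces-free -/

section Chart

variable {S : ℕ → LocDomainSys} {M m : ℕ → ℕ}

/-- **The chart obligation, PIECES-FREE** — print [I] §4 (4.3)–(4.4) p. 281: the localized term composed with the background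
field in local coordinates *"is defined and analytic on the space of configurations 𝐀 satisfying max{|𝐀|_X, |P₁(□₀)𝐀|_X,
|∇^ξ𝐀|_X, |Δ^ξ𝐀|_X} < α₂. (4.4)"*, obtained from §3's analytic extension (3.36)–(3.54) pp. 277–280 of the minimal configurations
into the spaces U^c (via [15]): for every member `n` and domain `X`, the NAMED chart `χ n X` (background field in the `m n`
local coordinates) is entire and maps the `α₂`-ball into the NAMED space `Uc n X`.  Only `Uc` and `χ` occur — no pieces; `α₂`
absolute, outside.  (Same shape as the NODE-O cover's Summit-side `ChartObligationsOver`.)  Asserted for nothing.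
[cite: Balaban1987RG1, (4.4) p.281 with (3.36)–(3.54) pp.277–280] -/
def Chart44 (S : ℕ → LocDomainSys) (M : ℕ → ℕ) (Uc : (n : ℕ) → (S n).Dom → Set (Fin (M n) → ℂ)) (m : ℕ → ℕ)
    (χ : (n : ℕ) → (S n).Dom → (Fin (m n) → ℂ) → (Fin (M n) → ℂ)) (α₂ : ℝ) : Prop :=
  (∀ n X, AnalyticOnNhd ℂ (χ n X) Set.univ) ∧ ∀ n X, Set.MapsTo (χ n X) (Metric.ball 0 α₂) (Uc n X)

variable {Uc : (n : ℕ) → (S n).Dom → Set (Fin (M n) → ℂ)} {χ : (n : ℕ) → (S n).Dom → (Fin (m n) → ℂ) → (Fin (M n) → ℂ)}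
  {α₂ E₀ κ : ℝ}

/-- **Format + chart ⟹ the charted pieces are analytic on the α₂-ball and obey (1.18) there** — the «row E» shape the NODE-O
line reads ((1.18)'s bound transported along the chart's `MapsTo`, analyticity by composition).  This is the CONTENT-FREE half
of the porting unit PT-C (its content = establishing `Chart44` ∕ the rows for the record); kept here so that the transport is
done once, in Literature currency.  Bookkeeping. [cite: Balaban1987RG1, (1.18) p.263 with (4.4)–(4.5) pp.281–282 (bookkeeping)] -/
theorem Chart44.rowE (hC : Chart44 S M Uc m χ α₂) {E : Pieces S M} (hA : Analytic19 Uc E) (hB : Bound118 S Uc E E₀ κ)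
    (n : ℕ) (X : (S n).Dom) :
    AnalyticOnNhd ℂ (E n X ∘ χ n X) (Metric.ball 0 α₂) ∧
      ∀ w ∈ Metric.ball (0 : Fin (m n) → ℂ) α₂, ‖E n X (χ n X w)‖ ≤ E₀ * Real.exp (-κ * (S n).dj X) := by
  refine ⟨fun w hw => ?_, fun w hw => hB n X (χ n X w) (hC.2 n X hw)⟩
  exact (hA n X (χ n X w) (hC.2 n X hw)).comp (hC.1 n X w (Set.mem_univ w))

/-- The mould + the chart hand the row-E data for SOME pieces together with the (S1) neighbourhood and the two-volume identity
of the SAME pieces (one shared family — the (J1) discipline). [cite: Balaban1987RG1, (1.6)–(1.7) p.261, (1.18) p.263, (4.4) p.281 (bookkeeping)] -/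
theorem FormatPlus.rowE_repr {W : ℕ → Type*} [∀ n, TopologicalSpace (W n)] [∀ n, Zero (W n)] {Φf : (n : ℕ) → W n → ℂ}
    {ι : (n : ℕ) → W n → (Fin (m n) → ℂ)} {coords : (n : ℕ) → (S n).Dom → Finset (Fin (M n))}
    {wrap : (n : ℕ) → Finset (S n).Dom} {emb : (n : ℕ) → (S n).Dom → (S (n + 1)).Dom}
    {πc : (n : ℕ) → (S n).Dom → (Fin (M (n + 1)) → ℂ) → (Fin (M n) → ℂ)}
    (h : FormatPlus S M Uc coords m χ Φf ι wrap emb πc E₀ κ) (hC : Chart44 S M Uc m χ α₂) :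
    ∃ E : Pieces S M,
      (∀ n X, AnalyticOnNhd ℂ (E n X ∘ χ n X) (Metric.ball 0 α₂) ∧
        ∀ w ∈ Metric.ball (0 : Fin (m n) → ℂ) α₂, ‖E n X (χ n X w)‖ ≤ E₀ * Real.exp (-κ * (S n).dj X)) ∧
      Local17 coords E ∧ (∀ n, ∃ U ∈ 𝓝 (0 : W n), ∀ B ∈ U, Φf n B = ∑ X : (S n).Dom, E n X (χ n X (ι n B))) ∧
      PieceVolIndep S M wrap emb πc E := by
  obtain ⟨E, hA, hB, hL, hR, hV⟩ := h
  exact ⟨E, fun n X => hC.rowE hA hB n X, hL, fun n => hR.exists_nhds n, hV⟩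

end Chart

/-! ## 6. The Ward row (v3 APPEND): [I] (4.13)–(4.14) p. 284 — «G is semisimple» in coordinates, and (1.19) ⟹ (4.14)
for the charted pieces -/

section WardRow

/-- **«G is semisimple» in coordinates** (p. 284: *"[λ, (δ∕δB)𝐄(1)] = 0 for all λ ∈ 𝔤^c. The group G is semisimple, hence
this is possible only for the element 0 in the algebra 𝔤^c"*): the linear action `A` of the constant rotations on the coordinate
space has NO non-zero invariant covector.  (Asked of the coordinate action, never of the pieces: for a group with centre,
e.g. U(N), `Im tr U_b` is gauge invariant with a non-zero central derivative — there this hypothesis fails, as it should.)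
[cite: Balaban1987RG1, (4.13)–(4.14) p.284] -/
def NoInvariantCovector {𝕜 : Type*} [NontriviallyNormedField 𝕜] {V : Type*} [NormedAddCommGroup V] [NormedSpace 𝕜 V] {G : Type*}
    (A : G → (V →L[𝕜] V)) : Prop :=
  ∀ φ : V →L[𝕜] 𝕜, (∀ g, φ.comp (A g) = φ) → φ = 0

/-- **(4.13) ⇒ (4.14) in coordinates**: a function invariant near `0` under linear maps `A g` with no common invariant covector,
differentiable at `0`, has `Df(0) = 0` — chain rule: `Df(0) = Df(0) ∘ A g` for every `g`. [cite: Balaban1987RG1, (4.13)–(4.14) p.284] -/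
theorem fderiv_eq_zero_of_invariant_noFixedCovector {𝕜 : Type*} [NontriviallyNormedField 𝕜] {V : Type*} [NormedAddCommGroup V]
    [NormedSpace 𝕜 V] {G : Type*} {f : V → 𝕜} (A : G → (V →L[𝕜] V)) (hinv : ∀ g, (fun v => f (A g v)) =ᶠ[𝓝 0] f)
    (hd : DifferentiableAt 𝕜 f 0) (hA : NoInvariantCovector A) : fderiv 𝕜 f 0 = 0 := by
  refine hA _ fun g => ?_
  have hd' : HasFDerivAt f (fderiv 𝕜 f 0) (A g 0) := by rw [map_zero]; exact hd.hasFDerivAt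
  have h2 : HasFDerivAt (fun v => f (A g v)) ((fderiv 𝕜 f 0).comp (A g)) 0 := hd'.comp 0 (A g).hasFDerivAt
  rw [← h2.fderiv]
  exact (hinv g).fderiv_eq

variable {S : ℕ → LocDomainSys} {M m : ℕ → ℕ}

/-- **(4.14) for the pieces through the chart, at the origin of chart coordinates**: `D(𝐄^{(j)}(X, ·) ∘ χ_X)(0) = 0` — print's
*"first, very important consequence of the gauge invariance (δ∕δB)𝐄(1) = 0 (4.14)"*, per localized piece ((1.19) holds
piecewise).  Hypothesis form. [cite: Balaban1987RG1, (4.14) p.284, (1.19) p.263] -/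
def Ward414 (χ : (n : ℕ) → (S n).Dom → (Fin (m n) → ℂ) → (Fin (M n) → ℂ)) (E : Pieces S M) : Prop :=
  ∀ n X, fderiv ℂ (fun u => E n X (χ n X u)) 0 = 0

/-- **The chart intertwines the constant rotations** (pieces-free bookkeeping about NAMES): the rotations `A n h` are indexed by
their OWN family `H n` (print: the structure group 𝐆 acting by constant rotations) with a NAMED map `toG n : H n → G n` into the
(1.10) gauge group (the constant gauge transformation), and `χ n X` carries `A n h` on chart inputs to `act n (toG n h)` on
configurations — for the exponential chart, `exp(i Ad_h B) = h exp(iB) h⁻¹` ((4.8) with constant λ).  (Indexing the rotations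
by the FULL gauge group would be uninhabitable: at `u = 0` every `g` would have to fix the chart origin.)
[cite: Balaban1987RG1, (1.10) p.262, (4.8) p.283] -/
def ChartEquivariant {H G : ℕ → Type*} (toG : (n : ℕ) → H n → G n) (act : (n : ℕ) → G n → (Fin (M n) → ℂ) → (Fin (M n) → ℂ))
    (χ : (n : ℕ) → (S n).Dom → (Fin (m n) → ℂ) → (Fin (M n) → ℂ)) (A : (n : ℕ) → H n → ((Fin (m n) → ℂ) →L[ℂ] (Fin (m n) → ℂ))) : Prop :=
  ∀ n X (h : H n) (u : Fin (m n) → ℂ), χ n X (A n h u) = act n (toG n h) (χ n X u)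

/-- **(1.19) + semisimplicity ⇒ (4.14) for the charted pieces** (p. 284's three lines, per piece): gauge invariance of the
pieces under the NAMED action, an equivariant entire chart into the spaces (4.4), analyticity (1.9), and no invariant covector
for the coordinate action give `Ward414`. [cite: Balaban1987RG1, (1.19) p.263, (4.4) p.281, (4.13)–(4.14) p.284] -/
theorem ward414_of_gaugeInv119 {H G : ℕ → Type*} {toG : (n : ℕ) → H n → G n} {act : (n : ℕ) → G n → (Fin (M n) → ℂ) → (Fin (M n) → ℂ)}
    {Uc : (n : ℕ) → (S n).Dom → Set (Fin (M n) → ℂ)} {E : Pieces S M} {χ : (n : ℕ) → (S n).Dom → (Fin (m n) → ℂ) → (Fin (M n) → ℂ)}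
    {A : (n : ℕ) → H n → ((Fin (m n) → ℂ) →L[ℂ] (Fin (m n) → ℂ))} {α₂ : ℝ}
    (hG : GaugeInv119 act Uc E) (hχ : ChartEquivariant toG act χ A) (hC : Chart44 S M Uc m χ α₂) (hα : 0 < α₂) (hA : Analytic19 Uc E)
    (hN : ∀ n, NoInvariantCovector (A n)) : Ward414 χ E := by
  intro n X
  refine fderiv_eq_zero_of_invariant_noFixedCovector (A n) (fun g => Filter.Eventually.of_forall fun v => ?_) ?_ (hN n)
  · show E n X (χ n X (A n g v)) = E n X (χ n X v)
    rw [hχ n X g v, hG.2 n (toG n g) X]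
  · exact ((hA n X (χ n X 0) (hC.2 n X (Metric.mem_ball_self hα))).comp (hC.1 n X 0 (Set.mem_univ _))).differentiableAt

end WardRow

/-! ## 7. The moulds with a sixth conjunct for the SAME pieces (v3 APPEND): (1.19) under the `∃` (`FormatPlusG`), and its
Ward shadow `FormatPlusW` (what the (4.35) bridge consumes) -/

section FormatG

variable {S : ℕ → LocDomainSys} {M m : ℕ → ℕ}

/-- **FORMAT⁺ᴳ = FORMAT⁺ ∧ (1.19) for the SAME pieces** (one `∃` over the pieces; the NAMED action `act` a parameter): the
mould the porting item 27930⁗ reads. [cite: Balaban1987RG1, (1.6)–(1.9) p.261, (1.18)–(1.19) p.263, (1.21) p.264] -/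
def FormatPlusG (S : ℕ → LocDomainSys) (M : ℕ → ℕ) {G : ℕ → Type*} (act : (n : ℕ) → G n → (Fin (M n) → ℂ) → (Fin (M n) → ℂ))
    (Uc : (n : ℕ) → (S n).Dom → Set (Fin (M n) → ℂ)) (coords : (n : ℕ) → (S n).Dom → Finset (Fin (M n))) (m : ℕ → ℕ)
    (χ : (n : ℕ) → (S n).Dom → (Fin (m n) → ℂ) → (Fin (M n) → ℂ)) {W : ℕ → Type*} [∀ n, TopologicalSpace (W n)]
    [∀ n, Zero (W n)] (Φf : (n : ℕ) → W n → ℂ) (ι : (n : ℕ) → W n → (Fin (m n) → ℂ))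
    (wrap : (n : ℕ) → Finset (S n).Dom) (emb : (n : ℕ) → (S n).Dom → (S (n + 1)).Dom)
    (πc : (n : ℕ) → (S n).Dom → (Fin (M (n + 1)) → ℂ) → (Fin (M n) → ℂ)) (E₀ κ : ℝ) : Prop :=
  ∃ E : Pieces S M, Analytic19 Uc E ∧ Bound118 S Uc E E₀ κ ∧ Local17 coords E ∧ Repr17 S E χ Φf ι ∧
    PieceVolIndep S M wrap emb πc E ∧ GaugeInv119 act Uc E

/-- **FORMAT⁺ᵂ = FORMAT⁺ ∧ (4.14) for the SAME pieces** — the hypothesis-form fallback and the shape the (4.35) bridge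
consumes. [cite: Balaban1987RG1, (1.6)–(1.9) p.261, (1.18) p.263, (4.14) p.284] -/
def FormatPlusW (S : ℕ → LocDomainSys) (M : ℕ → ℕ) (Uc : (n : ℕ) → (S n).Dom → Set (Fin (M n) → ℂ))
    (coords : (n : ℕ) → (S n).Dom → Finset (Fin (M n))) (m : ℕ → ℕ)
    (χ : (n : ℕ) → (S n).Dom → (Fin (m n) → ℂ) → (Fin (M n) → ℂ)) {W : ℕ → Type*} [∀ n, TopologicalSpace (W n)]
    [∀ n, Zero (W n)] (Φf : (n : ℕ) → W n → ℂ) (ι : (n : ℕ) → W n → (Fin (m n) → ℂ))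
    (wrap : (n : ℕ) → Finset (S n).Dom) (emb : (n : ℕ) → (S n).Dom → (S (n + 1)).Dom)
    (πc : (n : ℕ) → (S n).Dom → (Fin (M (n + 1)) → ℂ) → (Fin (M n) → ℂ)) (E₀ κ : ℝ) : Prop :=
  ∃ E : Pieces S M, Analytic19 Uc E ∧ Bound118 S Uc E E₀ κ ∧ Local17 coords E ∧ Repr17 S E χ Φf ι ∧
    PieceVolIndep S M wrap emb πc E ∧ Ward414 χ E

variable {Uc : (n : ℕ) → (S n).Dom → Set (Fin (M n) → ℂ)} {coords : (n : ℕ) → (S n).Dom → Finset (Fin (M n))}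
  {χ : (n : ℕ) → (S n).Dom → (Fin (m n) → ℂ) → (Fin (M n) → ℂ)} {W : ℕ → Type*} [∀ n, TopologicalSpace (W n)] [∀ n, Zero (W n)]
  {Φf : (n : ℕ) → W n → ℂ} {ι : (n : ℕ) → W n → (Fin (m n) → ℂ)} {wrap : (n : ℕ) → Finset (S n).Dom}
  {emb : (n : ℕ) → (S n).Dom → (S (n + 1)).Dom} {πc : (n : ℕ) → (S n).Dom → (Fin (M (n + 1)) → ℂ) → (Fin (M n) → ℂ)} {E₀ κ α₂ : ℝ}

/-- One-way bookkeeping: the six-row mould gives the five-row one. [cite: Balaban1987RG1, (1.6)–(1.9) p.261 (bookkeeping)] -/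
theorem formatPlus_of_formatPlusG {G : ℕ → Type*} {act : (n : ℕ) → G n → (Fin (M n) → ℂ) → (Fin (M n) → ℂ)}
    (h : FormatPlusG S M act Uc coords m χ Φf ι wrap emb πc E₀ κ) : FormatPlus S M Uc coords m χ Φf ι wrap emb πc E₀ κ := by
  obtain ⟨E, hA, hB, hL, hR, hV, -⟩ := h
  exact ⟨E, hA, hB, hL, hR, hV⟩

/-- One-way bookkeeping: the Ward mould gives the five-row one. [cite: Balaban1987RG1, (1.6)–(1.9) p.261 (bookkeeping)] -/
theorem formatPlus_of_formatPlusW (h : FormatPlusW S M Uc coords m χ Φf ι wrap emb πc E₀ κ) :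
    FormatPlus S M Uc coords m χ Φf ι wrap emb πc E₀ κ := by
  obtain ⟨E, hA, hB, hL, hR, hV, -⟩ := h
  exact ⟨E, hA, hB, hL, hR, hV⟩

/-- **(1.19)-mould + equivariant chart + no invariant covector ⟹ Ward-mould, for the SAME pieces** (one `∃`: the pieces of the
conclusion ARE the pieces of the hypothesis). [cite: Balaban1987RG1, (1.19) p.263, (4.13)–(4.14) p.284] -/
theorem formatPlusW_of_formatPlusG {H G : ℕ → Type*} {toG : (n : ℕ) → H n → G n} {act : (n : ℕ) → G n → (Fin (M n) → ℂ) → (Fin (M n) → ℂ)}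
    {A : (n : ℕ) → H n → ((Fin (m n) → ℂ) →L[ℂ] (Fin (m n) → ℂ))}
    (h : FormatPlusG S M act Uc coords m χ Φf ι wrap emb πc E₀ κ) (hχ : ChartEquivariant toG act χ A) (hC : Chart44 S M Uc m χ α₂) (hα : 0 < α₂)
    (hN : ∀ n, NoInvariantCovector (A n)) : FormatPlusW S M Uc coords m χ Φf ι wrap emb πc E₀ κ := by
  obtain ⟨E, hA, hB, hL, hR, hV, hG⟩ := h
  exact ⟨E, hA, hB, hL, hR, hV, ward414_of_gaugeInv119 hG hχ hC hα hA hN⟩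

/-- The Ward mould + the chart hand, for the SAME pieces: pieces∘chart `C²` over `ℂ` at `0` (indeed analytic on the α₂-ball),
locality, the (S1) neighbourhood, the two-volume identity, AND (4.14) — the binder list the (4.35) bridge consumes (p. 290:
*"For n = 2, and by the identity (4.14), the formula (4.3) yields … (4.35)"*).
[cite: Balaban1987RG1, (1.6)–(1.7) p.261 and p.263, (4.4) p.281, (4.14) p.284, (4.35) p.290 (bookkeeping)] -/
theorem FormatPlusW.rows_for_435 (h : FormatPlusW S M Uc coords m χ Φf ι wrap emb πc E₀ κ) (hC : Chart44 S M Uc m χ α₂) (hα : 0 < α₂) :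
    ∃ E : Pieces S M,
      (∀ n X, ContDiffAt ℂ 2 (fun u => E n X (χ n X u)) 0) ∧ Local17 coords E ∧
      (∀ n, ∃ U ∈ 𝓝 (0 : W n), ∀ B ∈ U, Φf n B = ∑ X : (S n).Dom, E n X (χ n X (ι n B))) ∧
      PieceVolIndep S M wrap emb πc E ∧ Ward414 χ E := by
  obtain ⟨E, hA, hB, hL, hR, hV, hW⟩ := h
  refine ⟨E, fun n X => ?_, hL, fun n => hR.exists_nhds n, hV, hW⟩
  exact ((hA n X (χ n X 0) (hC.2 n X (Metric.mem_ball_self hα))).comp (hC.1 n X 0 (Set.mem_univ _))).contDiffAt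

end FormatG

/-! ## 8. The RESPONSE side (v4 APPEND): [15] Prop. 9 response decay, the coordinate width of the chart inputs, and the
two-volume bookkeeping the (1.21) limit uses (unwrap compatibility, response comparison on a window, chart intertwining) —
GENERIC data, hypothesis form, asserted for nothing -/

section Response

variable {S : ℕ → LocDomainSys} {M m : ℕ → ℕ}

/-- The coordinate RESTRICTION map along an index map `j` on a coordinate set `cX`: pull the coordinates `j i`, `i ∈ cX`,
of the larger volume back, zero elsewhere — a continuous linear map (the map through which the chart of `X` in the
smaller volume reads the chart inputs of `X` in the larger one). [cite: Balaban1987RG1, (1.7) p.261 with (1.21) p.264 (bookkeeping)] -/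
def restrictCLM {m₁ m₂ : ℕ} (cX : Finset (Fin m₁)) (j : Fin m₁ → Fin m₂) : (Fin m₂ → ℂ) →L[ℂ] (Fin m₁ → ℂ) :=
  ContinuousLinearMap.pi fun i => if i ∈ cX then ContinuousLinearMap.proj (j i) else 0

/-- `restrictCLM` coordinatewise: `(restrictCLM cX j u) i = u (j i)` on `cX`, `0` off it (bookkeeping for the intertwining row (R5)). [cite: Balaban1987RG1, (1.7) p.261 with (4.35) p.290 (bookkeeping)] -/
theorem restrictCLM_apply {m₁ m₂ : ℕ} (cX : Finset (Fin m₁)) (j : Fin m₁ → Fin m₂) (u : Fin m₂ → ℂ) (i : Fin m₁) :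
    restrictCLM cX j u i = if i ∈ cX then u (j i) else 0 := by
  unfold restrictCLM
  rw [ContinuousLinearMap.pi_apply]
  split_ifs <;> simp

/-- **The RESPONSE DATA of a family, generic** (every field a NAME at instantiation; for the NODE-O record: DEF-1's
`recordCc ∕ RespLabel ∕ recordSiteGeom ∕ recordRho ∕ recordE ∕ recordCX ∕ recordSiteOf ∕ recordGk ∕ recordWrap ∕ recordDomEmb ∕
recordJX ∕ recordCoordProj`).  Per member `n` of the family: the cube cover `Cc n` of the catalogue `S n` (print p. 257: the
cubes □ of π_j and the domains X ∈ 𝐃_j as unions of cubes), the response LABELS `Λ n` (the unit-lattice bond variables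
`B_μ(y)` of (1.20), p. 264), the site geometry `G n` (dist(y, □), dist(y, X) — `B12Decay510.SiteGeometry`), the label
metric `ρ n`, the WINDOW labels `e n μ z` (direction `μ`, lattice vector `z ∈ ℤ^d` — the arguments of the kernel
`Π_{μν}(z)` of (1.20)–(1.21)), the chart-input indices `cX n X` «in X» (p. 261 (1.7), p. 281 (4.3)), the label `siteOf n i`
over a chart input, the RESPONSES `Gk n y i` = the linearisation at `0` of the chart-input coordinates in the label
variables (print: the derivative of the background field `H_k(B)` in `B`, [15] (182) p. 307), the exceptional class
`wrap n`, the domain embedding `emb n` and the chart-index lift `jX n X` into the next member, and the coordinate projection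
`πc n X` back (the two-volume data of (1.21) p. 264).  A carrier; asserts nothing.
[cite: Balaban1987RG1, p.257, (1.7) p.261, (1.20)–(1.21) p.264, (4.3) p.281; Balaban1985Variational, Prop. 9 p.309] -/
structure Response9Data (S : ℕ → LocDomainSys) (M m : ℕ → ℕ) (d : ℕ) where
  /-- the cube cover of `S n` (cubes □ ∈ π_j, `above □ = {X ⊇ □}`) -/
  Cc : (n : ℕ) → B12.CubeCover (S n)
  /-- the response labels (unit-lattice bond variables `B_μ(y)`) -/
  Λ : ℕ → Type
  /-- dist(y, □), dist(y, X) -/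
  G : (n : ℕ) → B12Decay510.SiteGeometry (Cc n) (Λ n)
  /-- the label metric -/
  ρ : (n : ℕ) → Λ n → Λ n → ℝ
  /-- the window labels: direction `μ` at lattice vector `z` -/
  e : (n : ℕ) → Fin d → (Fin d → ℤ) → Λ n
  /-- the chart-input indices «in X» -/
  cX : (n : ℕ) → (S n).Dom → Finset (Fin (m n))
  /-- the label over a chart input -/
  siteOf : (n : ℕ) → Fin (m n) → Λ n
  /-- the responses `∂(chart input i)∕∂(label y)` at `0` -/
  Gk : (n : ℕ) → Λ n → Fin (m n) → ℂ
  /-- the exceptional class of member `n` (domains not carried into member `n + 1`) -/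
  wrap : (n : ℕ) → Finset (S n).Dom
  /-- the domain embedding into the next member -/
  emb : (n : ℕ) → (S n).Dom → (S (n + 1)).Dom
  /-- the chart-index lift into the next member -/
  jX : (n : ℕ) → (S n).Dom → Fin (m n) → Fin (m (n + 1))
  /-- the coordinate projection back from the next member -/
  πc : (n : ℕ) → (S n).Dom → (Fin (M (n + 1)) → ℂ) → (Fin (M n) → ℂ)

/-- **THE RESPONSE OBLIGATIONS «Prop. 9», generic, hypothesis form** — for NAMED response data `R`, a NAMED chart `χ` and a
NAMED window size `N n`, with the constants `C₉ δ₀ w` given from OUTSIDE: (R0) `0 ≤ C₉`, `0 ≤ δ₀`, `0 ≤ w`; (R1) RESPONSE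
DECAY — [15] Prop. 9 p. 309, verbatim: *"The minimal configuration U_k(V) = U_k(V′V₀) in the axial gauge has an extension to
an analytic function of G^c-valued small configurations V … The function ℋ_k(B) … is an analytic function of B … and its
functional derivative (182) satisfies the inequalities (190)"* (exponential decay of `δℋ_k(B)(x)∕δB(y)` in the scaled
distance of `x` to `y`), in coordinates: `‖Gk n y i‖ ≤ C₉·exp(−δ₀·ρ(siteOf i, y))`; used in [I] as p. 282: *"if one of the
functions B_i is localized outside the domain X, then we have the additional exponential factor exp(−δ₀dist^{(ξ)}(X,
supp B_i))"*; (R2) COORDINATE WIDTH — the chart inputs of `X` lie within `w` of `X`: `dist(y, X) ≤ ρ(siteOf i, y) + w` for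
`i ∈ cX n X` ((1.7) locality read on the chart side; explicit form OURS); (R3) UNWRAP COMPATIBILITY — off the exceptional
class, the lift `jX` carries the chart inputs of `X` into those of `emb X`; (R4) TWO-VOLUME RESPONSE COMPARISON — off the
exceptional class, on the window `2|z_l| < N n` the responses of members `n` and `n + 1` at corresponding labels agree up to
`C₉·e^{−δ₀N∕2}·e^{−(δ₀∕2)ρ}` (the configuration-level input of the limit (1.21) p. 264 *"This limit exists by the localized
representation (1.7)"*; the explicit two-volume form with a RATE is OURS — IMPLICIT in print); (R5) CHART INTERTWINING —
off the exceptional class, projecting the larger member's chart of `emb X` back equals the smaller member's chart of `X` on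
the restricted inputs ((4.35) p. 290 reads the pieces through the chart of the background field `H(□₀)`; explicit form
OURS).  (Field-for-field the NODE-O cover's Summit-side `ResponseObligationsOver`, at `d = 4`.)  Asserted for nothing.
[cite: Balaban1985Variational, Prop. 9 p.309 with (182) p.307, (190) p.308; Balaban1987RG1, (1.7) p.261, (1.21) p.264, (4.5) p.282, (4.35) p.290] -/
def Response9 {d : ℕ} (R : Response9Data S M m d) (χ : (n : ℕ) → (S n).Dom → (Fin (m n) → ℂ) → (Fin (M n) → ℂ))
    (N : ℕ → ℕ) (C₉ δ₀ w : ℝ) : Prop :=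
  0 ≤ C₉ ∧ 0 ≤ δ₀ ∧ 0 ≤ w ∧
  (∀ n y i, ‖R.Gk n y i‖ ≤ C₉ * Real.exp (-δ₀ * R.ρ n (R.siteOf n i) y)) ∧
  (∀ n X, ∀ i ∈ R.cX n X, ∀ y, (R.G n).distD y X ≤ R.ρ n (R.siteOf n i) y + w) ∧
  (∀ n X, X ∉ R.wrap n → ∀ i ∈ R.cX n X, R.jX n X i ∈ R.cX (n + 1) (R.emb n X)) ∧
  (∀ n X, X ∉ R.wrap n → ∀ i ∈ R.cX n X, ∀ (μ : Fin d) (z : Fin d → ℤ), (∀ l, 2 * |z l| < (N n : ℤ)) →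
    ‖R.Gk (n + 1) (R.e (n + 1) μ z) (R.jX n X i) - R.Gk n (R.e n μ z) i‖ ≤
      C₉ * Real.exp (-δ₀ * (N n : ℝ) / 2) * Real.exp (-(δ₀ / 2) * R.ρ n (R.siteOf n i) (R.e n μ z))) ∧
  (∀ n X, X ∉ R.wrap n → ∀ w', R.πc n X (χ (n + 1) (R.emb n X) w') = χ n X (restrictCLM (R.cX n X) (R.jX n X) w'))

variable {d : ℕ} {R : Response9Data S M m d} {χ : (n : ℕ) → (S n).Dom → (Fin (m n) → ℂ) → (Fin (M n) → ℂ)} {N : ℕ → ℕ}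
  {C₉ δ₀ w : ℝ}

/-- The constants of `Response9` are non-negative (row (R0), bookkeeping). [cite: Balaban1985Variational, Prop. 9 p.309 (bookkeeping)] -/
theorem Response9.consts_nonneg (h : Response9 R χ N C₉ δ₀ w) : 0 ≤ C₉ ∧ 0 ≤ δ₀ ∧ 0 ≤ w :=
  ⟨h.1, h.2.1, h.2.2.1⟩

/-- Row (R1) of `Response9`: the response decay at every member, label and chart input. [cite: Balaban1985Variational, Prop. 9 p.309, (190) p.308] -/
theorem Response9.decay (h : Response9 R χ N C₉ δ₀ w) (n : ℕ) (y : R.Λ n) (i : Fin (m n)) :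
    ‖R.Gk n y i‖ ≤ C₉ * Real.exp (-δ₀ * R.ρ n (R.siteOf n i) y) :=
  h.2.2.2.1 n y i

/-- Rows (R1) + (R2) combined: for a chart input `i` of `X`, the response is bounded by `C₉·e^{δ₀w}·e^{−δ₀dist(y, X)}` —
the *"additional exponential factor exp(−δ₀dist(X, supp B_i))"* of [I] p. 282 in coordinates. [cite: Balaban1987RG1, (4.5) p.282; Balaban1985Variational, Prop. 9 p.309] -/
theorem Response9.decay_distD (h : Response9 R χ N C₉ δ₀ w) (n : ℕ) (X : (S n).Dom) {i : Fin (m n)} (hi : i ∈ R.cX n X)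
    (y : R.Λ n) : ‖R.Gk n y i‖ ≤ C₉ * Real.exp (δ₀ * w) * Real.exp (-δ₀ * (R.G n).distD y X) := by
  obtain ⟨hC, hδ, -, hdec, hwid, -⟩ := h
  refine (hdec n y i).trans ?_
  rw [mul_assoc, ← Real.exp_add]
  refine mul_le_mul_of_nonneg_left (Real.exp_le_exp.mpr ?_) hC
  have := hwid n X i hi y
  nlinarith

/-- Row (R5) of `Response9`: the chart intertwining off the exceptional class. [cite: Balaban1987RG1, (4.35) p.290 with (1.21) p.264 (bookkeeping)] -/
theorem Response9.intertwine (h : Response9 R χ N C₉ δ₀ w) (n : ℕ) (X : (S n).Dom) (hX : X ∉ R.wrap n)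
    (w' : Fin (m (n + 1)) → ℂ) : R.πc n X (χ (n + 1) (R.emb n X) w') = χ n X (restrictCLM (R.cX n X) (R.jX n X) w') :=
  h.2.2.2.2.2.2.2 n X hX w'

end Response

/-! ## 9. The chart and the responses on a NAMED DOMAIN in print's SCALED norms (v5 APPEND; the cell's repair «R-O2» of record):
(4.4) p. 281 is a convex balanced neighbourhood of 0 thin in the rough directions, NOT a k-uniform polydisc in unscaled chart
coordinates; the response rows are measured by the Minkowski GAUGE of that domain -/

section ScaledDomain

open _root_.Metric

variable {S : ℕ → LocDomainSys} {M m : ℕ → ℕ}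

/-- **The chart obligation ON A NAMED DOMAIN** — print [I] (4.4) p. 281, verbatim: *"it is defined and analytic on the space of
configurations 𝐀 satisfying max{|𝐀|_X, |P₁(□₀)𝐀|_X, |∇^ξ𝐀|_X, |Δ^ξ𝐀|_X} < α₂. (4.4)"* — a CONVEX, BALANCED, OPEN neighbourhood of
`0` in chart coordinates (thin in the rough directions through the ξ-scaled differences), on which the NAMED chart `χ n X` is
analytic and which it maps into the NAMED space `Uc n X`.  The domain `D n X` is a PARAMETER (for the record: the definer's
`recordDom44`); the polydisc `D := ball 0 α₂` is the special case `Chart44` (`chart44D_ball_of_chart44`), which print does NOT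
grant uniformly in the level.  Pieces-free; asserted for nothing. [cite: Balaban1987RG1, (4.4) p.281 with (3.36)–(3.54) pp.277–280] -/
def Chart44D (S : ℕ → LocDomainSys) (M : ℕ → ℕ) (Uc : (n : ℕ) → (S n).Dom → Set (Fin (M n) → ℂ)) (m : ℕ → ℕ)
    (χ : (n : ℕ) → (S n).Dom → (Fin (m n) → ℂ) → (Fin (M n) → ℂ)) (D : (n : ℕ) → (S n).Dom → Set (Fin (m n) → ℂ)) : Prop :=
  ∀ n X, Convex ℝ (D n X) ∧ Balanced ℂ (D n X) ∧ IsOpen (D n X) ∧ (0 : Fin (m n) → ℂ) ∈ D n X ∧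
    AnalyticOnNhd ℂ (χ n X) (D n X) ∧ Set.MapsTo (χ n X) (D n X) (Uc n X)

variable {Uc : (n : ℕ) → (S n).Dom → Set (Fin (M n) → ℂ)} {χ : (n : ℕ) → (S n).Dom → (Fin (m n) → ℂ) → (Fin (M n) → ℂ)}
  {D : (n : ℕ) → (S n).Dom → Set (Fin (m n) → ℂ)} {α₂ E₀ κ : ℝ}

/-- The polydisc chart obligation `Chart44 … α₂` (α₂ > 0) is `Chart44D` at `D := ball 0 α₂` (balls are convex, balanced and
open).  Bookkeeping: the v2 row is the special case. [cite: Balaban1987RG1, (4.4) p.281 (bookkeeping)] -/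
theorem chart44D_ball_of_chart44 (hC : Chart44 S M Uc m χ α₂) (hα : 0 < α₂) :
    Chart44D S M Uc m χ (fun n _ => ball (0 : Fin (m n) → ℂ) α₂) := by
  intro n X
  exact ⟨convex_ball _ _, balanced_ball_zero, isOpen_ball, mem_ball_self hα,
    fun w hw => hC.1 n X w (Set.mem_univ w), hC.2 n X⟩

/-- **Format + chart-on-a-domain ⟹ the charted pieces are analytic ON THE DOMAIN and obey (1.18) there** (the «row E» shape on
`D`, content-free transport of (1.18) along `MapsTo`; the `Chart44.rowE` of v2 is the polydisc case).
[cite: Balaban1987RG1, (1.18) p.263 with (4.4)–(4.5) pp.281–282 (bookkeeping)] -/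
theorem Chart44D.rowE (hC : Chart44D S M Uc m χ D) {E : Pieces S M} (hA : Analytic19 Uc E) (hB : Bound118 S Uc E E₀ κ)
    (n : ℕ) (X : (S n).Dom) :
    AnalyticOnNhd ℂ (E n X ∘ χ n X) (D n X) ∧
      ∀ w ∈ D n X, ‖E n X (χ n X w)‖ ≤ E₀ * Real.exp (-κ * (S n).dj X) := by
  refine ⟨fun w hw => ?_, fun w hw => hB n X (χ n X w) ((hC n X).2.2.2.2.2 hw)⟩
  exact (hA n X (χ n X w) ((hC n X).2.2.2.2.2 hw)).comp ((hC n X).2.2.2.2.1 w hw)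

/-- A coordinate vector CUT to a coordinate set: kept on `cX`, zero elsewhere (the response of one label read on the chart
inputs of one domain). [cite: Balaban1987RG1, (4.35) p.290 (bookkeeping)] -/
def cutTo {m₁ : ℕ} (cX : Finset (Fin m₁)) (u : Fin m₁ → ℂ) : Fin m₁ → ℂ :=
  fun i => if i ∈ cX then u i else 0

/-- `cutTo` coordinatewise. [cite: Balaban1987RG1, (4.35) p.290 (bookkeeping)] -/
theorem cutTo_apply {m₁ : ℕ} (cX : Finset (Fin m₁)) (u : Fin m₁ → ℂ) (i : Fin m₁) :
    cutTo cX u i = if i ∈ cX then u i else 0 := rfl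

/-- **THE RESPONSE OBLIGATIONS IN PRINT'S SCALED NORMS** — the rows of `Response9` with the two DECAY rows measured by the
Minkowski GAUGE (Mathlib `gauge`) of the NAMED chart domain `D n X` of `Chart44D`, for the response of a label `y` CUT to the
chart inputs of `X`: (R0) `0 ≤ C₉`, `0 ≤ δ₀`; (R1ᴰ) RESPONSE DECAY TOWARDS THE DOMAIN — [15] Prop. 9 p. 309 (*"its functional
derivative (182) satisfies the inequalities (190)"*: the derivative of the background field in the unit-lattice variables,
bounded in the SAME scaled norms with exponential decay) read as [I] p. 282: *"if one of the functions B_i is localized outside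
the domain X, then we have the additional exponential factor exp(−δ₀dist^{(ξ)}(X, supp B_i))"* — `gauge (D n X) (cutTo (cX n X)
(Gk n y)) ≤ C₉·e^{−δ₀·dist(y, X)}`; (R3) unwrap compatibility; (R4ᴰ) the TWO-VOLUME RESPONSE COMPARISON on the window
`2|z_l| < N n`, in the same gauge, at rate `e^{−δ₀N∕2}` (explicit form OURS — implicit in the limit (1.21) p. 264); (R5) the chart
intertwining.  Constants OUTSIDE, every datum a NAME; hypothesis form, asserted for nothing.  (The sup-norm predicate
`Response9` of §8 is the polydisc reading; this is the reading the line's k-uniform constants need.)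
[cite: Balaban1985Variational, Prop. 9 p.309 with (190) p.308; Balaban1987RG1, (4.4)–(4.5) pp.281–282, (1.21) p.264, (4.35) p.290] -/
def Response9D {d : ℕ} (R : Response9Data S M m d) (χ : (n : ℕ) → (S n).Dom → (Fin (m n) → ℂ) → (Fin (M n) → ℂ))
    (N : ℕ → ℕ) (D : (n : ℕ) → (S n).Dom → Set (Fin (m n) → ℂ)) (C₉ δ₀ : ℝ) : Prop :=
  0 ≤ C₉ ∧ 0 ≤ δ₀ ∧
  (∀ n X y, gauge (D n X) (cutTo (R.cX n X) (R.Gk n y)) ≤ C₉ * Real.exp (-δ₀ * (R.G n).distD y X)) ∧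
  (∀ n X, X ∉ R.wrap n → ∀ i ∈ R.cX n X, R.jX n X i ∈ R.cX (n + 1) (R.emb n X)) ∧
  (∀ n X, X ∉ R.wrap n → ∀ (μ : Fin d) (z : Fin d → ℤ), (∀ l, 2 * |z l| < (N n : ℤ)) →
    gauge (D n X) (cutTo (R.cX n X) fun i => R.Gk (n + 1) (R.e (n + 1) μ z) (R.jX n X i) - R.Gk n (R.e n μ z) i) ≤
      C₉ * Real.exp (-δ₀ * (N n : ℝ) / 2) * Real.exp (-(δ₀ / 2) * (R.G n).distD (R.e n μ z) X)) ∧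
  (∀ n X, X ∉ R.wrap n → ∀ w', R.πc n X (χ (n + 1) (R.emb n X) w') = χ n X (restrictCLM (R.cX n X) (R.jX n X) w'))

variable {d : ℕ} {R : Response9Data S M m d} {N : ℕ → ℕ} {C₉ δ₀ : ℝ}

/-- The constants of `Response9D` are non-negative (row (R0)). [cite: Balaban1985Variational, Prop. 9 p.309 (bookkeeping)] -/
theorem Response9D.consts_nonneg (h : Response9D R χ N D C₉ δ₀) : 0 ≤ C₉ ∧ 0 ≤ δ₀ :=
  ⟨h.1, h.2.1⟩

/-- Row (R1ᴰ): the gauge of the cut response decays in the distance of the label to the domain.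
[cite: Balaban1985Variational, Prop. 9 p.309; Balaban1987RG1, (4.5) p.282] -/
theorem Response9D.decay (h : Response9D R χ N D C₉ δ₀) (n : ℕ) (X : (S n).Dom) (y : R.Λ n) :
    gauge (D n X) (cutTo (R.cX n X) (R.Gk n y)) ≤ C₉ * Real.exp (-δ₀ * (R.G n).distD y X) :=
  h.2.2.1 n X y

/-- Row (R5) of `Response9D`: the chart intertwining off the exceptional class. [cite: Balaban1987RG1, (4.35) p.290 with (1.21) p.264 (bookkeeping)] -/
theorem Response9D.intertwine (h : Response9D R χ N D C₉ δ₀) (n : ℕ) (X : (S n).Dom) (hX : X ∉ R.wrap n)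
    (w' : Fin (m (n + 1)) → ℂ) : R.πc n X (χ (n + 1) (R.emb n X) w') = χ n X (restrictCLM (R.cX n X) (R.jX n X) w') :=
  h.2.2.2.2.2 n X hX w'

end ScaledDomain

end

end Literature.MathematicalPhysics.QuantumFieldTheory.Balaban1983to89.B12FormatPlus
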